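import Summits.CriticalPhenomena.Ising3D.Control2DBootstrap
import Literature.NumberTheory.Automorphic.ZhouLegendreGreenValuesProofs
import Mathlib.Analysis.Normed.Ring.InfiniteSum
import Mathlib.Analysis.SpecialFunctions.Pow.Real
import Mathlib.Tactic.Linarith
import Mathlib.Tactic.Ring
import Mathlib.Tactic.Positivity
import HarnessLib

/-!
# The 2D control: the termwise (`z`-series) reduction of the above-threshold obligation — proved
(cell `pub-ising3x`, seat controls-1; companion of `Control2DBootstrap.lean`)

HONEST FRAMING: lottery ticket; floor = tightest certified 3D Ising CFT bounds; no exact-solution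
claim without a proof.

`Control2DBootstrap.GapObligations.high_nonneg` asks for `φ[F_-[g_{Δ,ℓ}]] ≥ 0` for EVERY unitary
`(Δ, ℓ)` with `Δ ≥ E₀` — a continuum. Verifier A (`verify_points2d/1.1`, obligations (M) and (T))
discharges it TERMWISE: at a real point `(x, y) ∈ (0,1)²` the parity-symmetrised global block is a
double series with NON-NEGATIVE coefficients in "pair monomials",
`g_{Δ,ℓ}(x,y) = ∑_{m,m'} a_m(h) a_{m'}(h̄) (x^{h+m} y^{h̄+m'} + x^{h̄+m'} y^{h+m})`,
`a_m(h) = (h)_m² / (m! (2h)_m) ≥ 0` (`h, h̄ ≥ 0`), and a point functional acts on it term by term, so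
`φ[F_-[x^a y^b + x^b y^a]] ≥ 0` for all `a, b ≥ 0` with `a + b ≥ E₀`, `a - b ∈ ℤ` (verifier notation:
`E = a + b ≥ E₀`, `j = |a - b| ≤ E`; `φ[F_-[pairPow a b]] = 2Φ(E,j) = 2∑_d c_d s_d^E T_j(ξ_d)`) implies
`φ[F_-[g_{Δ,ℓ}]] ≥ 0` whenever `Δ ≥ max(ℓ, E₀)`. This file PROVES that implication
(`high_nonneg_of_pairPositive`) from Mathlib's hypergeometric series:

* `chiralCoeff h m` = Mathlib's `ordinaryHypergeometricCoefficient h h (2h) m`, `≥ 0` for `h ≥ 0`;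
* `hasSum_chiralBlock`: `k_{2h}(x) = ∑_m a_m(h) x^{h+m}` on `0 < x < 1`;
* `hasSum_blockPair` / `hasSum_crossF_globalBlock`: the pair-monomial double series above, on
  the open square, and its crossing combination;
* `PairPositiveAbove φ s E₀` — the (M)+(T) obligation — and `high_nonneg_of_pairPositive`.

(T) itself (that finitely many "apex bracket" inequalities give `PairPositiveAbove` beyond `Δ⋆`) and
(M) (interval Taylor forms on `[E₀, Δ⋆]`) remain the verifiers' computations / a later file.

Sources: F. A. Dolan, H. Osborn, Nucl. Phys. B 678 (2004) 491, §3 (the `ε = 0` blocks as products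
of `x^λ ₂F₁(λ,λ;2λ;x)`); G. E. Andrews, R. Askey, R. Roy, *Special Functions* (1999), §2.1 (the
`₂F₁` series, radius 1) via the tree's `Literature.NumberTheory.Automorphic.LegendreP.hasSum_ordinaryHypergeometric`;
R. Rattazzi, V. S. Rychkov, E. Tonni, A. Vichi, JHEP 12 (2008) 031, §5.5 (asymptotic/termwise control
of the functional outside the trial set). Mathlib: `HasSum.mul`, `Summable.mul_of_nonneg`,
`Equiv.hasSum_iff`, `Real.rpow_add`, `ascPochhammer_pos`.
-/

namespace Summit.CriticalPhenomena.Ising3D.Control2D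

open Set
open Literature.MathematicalPhysics.QuantumFieldTheory.ConformalBootstrap3D

/-! ### The chiral series -/

/-- The coefficient `a_m(h) = (h)_m (h)_m / (m! (2h)_m)` of `x^{h+m}` in `k_{2h}(x)` (Mathlib's
`ordinaryHypergeometricCoefficient h h (2h) m`; `a_0 = 1`, `a_{m+1} = a_m (h+m)²/((m+1)(2h+m))`).
[cite: DolanOsborn2004, §3] -/
noncomputable def chiralCoeff (h : ℝ) (m : ℕ) : ℝ :=
  ordinaryHypergeometricCoefficient h h (2 * h) m

/-- The ascending Pochhammer symbol is non-negative at a non-negative real argument. [folklore] -/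
theorem ascPochhammer_eval_nonneg (n : ℕ) {s : ℝ} (hs : 0 ≤ s) :
    0 ≤ (ascPochhammer ℝ n).eval s := by
  rcases hs.lt_or_eq with hpos | hzero
  · exact (ascPochhammer_pos n s hpos).le
  · subst hzero
    rw [ascPochhammer_eval_zero]
    split_ifs <;> norm_num

/-- `a_m(h) ≥ 0` for `h ≥ 0`. [folklore] -/
theorem chiralCoeff_nonneg {h : ℝ} (hh : 0 ≤ h) (m : ℕ) : 0 ≤ chiralCoeff h m := by
  unfold chiralCoeff ordinaryHypergeometricCoefficient
  have h1 : 0 ≤ (ascPochhammer ℝ m).eval h := ascPochhammer_eval_nonneg m hh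
  have h2 : 0 ≤ (ascPochhammer ℝ m).eval (2 * h) := ascPochhammer_eval_nonneg m (by linarith)
  have h3 : (0 : ℝ) ≤ ((m.factorial : ℝ))⁻¹ := inv_nonneg.mpr (Nat.cast_nonneg _)
  exact mul_nonneg (mul_nonneg (mul_nonneg h3 h1) h1) (inv_nonneg.mpr h2)

/-- **The chiral block as a series**: for `0 < x < 1`, `k_{2h}(x) = ∑_m a_m(h) x^{h+m}`
(`HasSum`). [cite: DolanOsborn2004, §3] -/
theorem hasSum_chiralBlock (h : ℝ) {x : ℝ} (hx0 : 0 < x) (hx1 : x < 1) :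
    HasSum (fun m : ℕ => chiralCoeff h m * x ^ (h + (m : ℝ))) (chiralBlock h x) := by
  have habs : |x| < 1 := by rw [abs_lt]; constructor <;> linarith
  have H := (Literature.NumberTheory.Automorphic.LegendreP.hasSum_ordinaryHypergeometric h h (2 * h)
    habs).mul_left (x ^ h)
  have hfun : (fun m : ℕ => chiralCoeff h m * x ^ (h + (m : ℝ))) =
      fun n : ℕ => x ^ h * (ordinaryHypergeometricCoefficient h h (2 * h) n * x ^ n) := by
    funext m
    rw [Real.rpow_add hx0, Real.rpow_natCast]
    unfold chiralCoeff
    ring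
  rw [hfun]
  exact H

/-! ### The pair-monomial expansion of the parity-symmetrised block -/

/-- The pair monomial `x^a y^b + x^b y^a` (verifier notation: `2 s^E T_j(ξ)` with `E = a + b`,
`j = |a - b|`, `s = √(xy)`, `ξ = (x+y)/(2s)`). [folklore] -/
noncomputable def pairPow (a b : ℝ) (x y : ℝ) : ℝ :=
  x ^ a * y ^ b + x ^ b * y ^ a

/-- The product of two chiral series at a point of the open square, as a double series over
`ℕ × ℕ` (`HasSum.mul`; summability of the product family from non-negativity, `h₁, h₂ ≥ 0`).
[folklore] -/
theorem hasSum_chiral_mul {h₁ h₂ x y : ℝ} (hh₁ : 0 ≤ h₁) (hh₂ : 0 ≤ h₂) (hx : x ∈ Ioo (0 : ℝ) 1)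
    (hy : y ∈ Ioo (0 : ℝ) 1) :
    HasSum (fun mm : ℕ × ℕ => (chiralCoeff h₁ mm.1 * x ^ (h₁ + (mm.1 : ℝ))) *
        (chiralCoeff h₂ mm.2 * y ^ (h₂ + (mm.2 : ℝ)))) (chiralBlock h₁ x * chiralBlock h₂ y) := by
  have Hx := hasSum_chiralBlock h₁ hx.1 hx.2
  have Hy := hasSum_chiralBlock h₂ hy.1 hy.2
  refine Hx.mul Hy (Hx.summable.mul_of_nonneg Hy.summable ?_ ?_)
  · intro m
    exact mul_nonneg (chiralCoeff_nonneg hh₁ m) (Real.rpow_nonneg hx.1.le _)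
  · intro m
    exact mul_nonneg (chiralCoeff_nonneg hh₂ m) (Real.rpow_nonneg hy.1.le _)

/-- **The block as a non-negative pair-monomial series.** For `(x, y)` in the open square and
`h, h̄ ≥ 0`, `k_{2h}(x) k_{2h̄}(y) + k_{2h̄}(x) k_{2h}(y) = ∑_{(m,m')} a_m(h) a_{m'}(h̄) ·
pairPow (h+m) (h̄+m') (x,y)` (`HasSum` over `ℕ × ℕ`; the second product is re-indexed by
`Equiv.prodComm`). [cite: DolanOsborn2004, §3] -/
theorem hasSum_blockPair {h hb x y : ℝ} (hh : 0 ≤ h) (hhb : 0 ≤ hb) (hx : x ∈ Ioo (0 : ℝ) 1)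
    (hy : y ∈ Ioo (0 : ℝ) 1) :
    HasSum (fun mm : ℕ × ℕ => chiralCoeff h mm.1 * chiralCoeff hb mm.2 *
        pairPow (h + (mm.1 : ℝ)) (hb + (mm.2 : ℝ)) x y)
      (chiralBlock h x * chiralBlock hb y + chiralBlock hb x * chiralBlock h y) := by
  have P1 := hasSum_chiral_mul hh hhb hx hy
  have P2 := (Equiv.prodComm ℕ ℕ).hasSum_iff.mpr (hasSum_chiral_mul hhb hh hx hy)
  have S := P1.add P2
  have hfun : (fun mm : ℕ × ℕ => chiralCoeff h mm.1 * chiralCoeff hb mm.2 *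
        pairPow (h + (mm.1 : ℝ)) (hb + (mm.2 : ℝ)) x y) =
      fun mm : ℕ × ℕ => (chiralCoeff h mm.1 * x ^ (h + (mm.1 : ℝ))) *
          (chiralCoeff hb mm.2 * y ^ (hb + (mm.2 : ℝ))) +
        ((fun mm : ℕ × ℕ => (chiralCoeff hb mm.1 * x ^ (hb + (mm.1 : ℝ))) *
          (chiralCoeff h mm.2 * y ^ (h + (mm.2 : ℝ)))) ∘ ⇑(Equiv.prodComm ℕ ℕ)) mm := by
    funext mm
    simp only [Function.comp_apply, Equiv.prodComm_apply, Prod.fst_swap, Prod.snd_swap, pairPow]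
    ring
  rw [hfun]
  exact S

/-- **Crossing of the expansion.** At every point of the open square, `F_-[g_{Δ,ℓ}]` is the same
non-negative combination of the `F_-[pairPow (h+m) (h̄+m')]` (`h = (Δ+ℓ)/2 ≥ 0`, `h̄ = (Δ-ℓ)/2 ≥ 0`).
Elementary (linearity of `crossF` in the block; both `(z,z̄)` and `(1-z,1-z̄)` lie in the square).
[folklore] -/
theorem hasSum_crossF_globalBlock {s Δ : ℝ} {ℓ : ℕ} (hΔ : (ℓ : ℝ) ≤ Δ) {z zb : ℝ}
    (hz : z ∈ Ioo (0 : ℝ) 1) (hzb : zb ∈ Ioo (0 : ℝ) 1) :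
    HasSum (fun mm : ℕ × ℕ => chiralCoeff ((Δ + ℓ) / 2) mm.1 * chiralCoeff ((Δ - ℓ) / 2) mm.2 *
        crossF s (-1) (pairPow ((Δ + ℓ) / 2 + (mm.1 : ℝ)) ((Δ - ℓ) / 2 + (mm.2 : ℝ))) z zb)
      (crossF s (-1) (globalBlock Δ ℓ) z zb) := by
  have hℓ : (0 : ℝ) ≤ ℓ := Nat.cast_nonneg ℓ
  have hh : 0 ≤ (Δ + ℓ) / 2 := by linarith
  have hhb : 0 ≤ (Δ - ℓ) / 2 := by linarith
  have hz' : 1 - z ∈ Ioo (0 : ℝ) 1 := ⟨by linarith [hz.2], by linarith [hz.1]⟩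
  have hzb' : 1 - zb ∈ Ioo (0 : ℝ) 1 := ⟨by linarith [hzb.2], by linarith [hzb.1]⟩
  have A := (hasSum_blockPair hh hhb hz hzb).mul_left (((1 - z) * (1 - zb)) ^ s)
  have B := (hasSum_blockPair hh hhb hz' hzb').mul_left ((-1) * (z * zb) ^ s)
  have AB := A.add B
  have hfun : (fun mm : ℕ × ℕ => chiralCoeff ((Δ + ℓ) / 2) mm.1 * chiralCoeff ((Δ - ℓ) / 2) mm.2 *
        crossF s (-1) (pairPow ((Δ + ℓ) / 2 + (mm.1 : ℝ)) ((Δ - ℓ) / 2 + (mm.2 : ℝ))) z zb) =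
      fun mm : ℕ × ℕ => ((1 - z) * (1 - zb)) ^ s *
          (chiralCoeff ((Δ + ℓ) / 2) mm.1 * chiralCoeff ((Δ - ℓ) / 2) mm.2 *
            pairPow ((Δ + ℓ) / 2 + (mm.1 : ℝ)) ((Δ - ℓ) / 2 + (mm.2 : ℝ)) z zb) +
        (-1) * (z * zb) ^ s *
          (chiralCoeff ((Δ + ℓ) / 2) mm.1 * chiralCoeff ((Δ - ℓ) / 2) mm.2 *
            pairPow ((Δ + ℓ) / 2 + (mm.1 : ℝ)) ((Δ - ℓ) / 2 + (mm.2 : ℝ)) (1 - z) (1 - zb)) := by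
    funext mm
    simp only [crossF]
    ring
  have hval : crossF s (-1) (globalBlock Δ ℓ) z zb =
      ((1 - z) * (1 - zb)) ^ s *
          (chiralBlock ((Δ + ℓ) / 2) z * chiralBlock ((Δ - ℓ) / 2) zb +
            chiralBlock ((Δ - ℓ) / 2) z * chiralBlock ((Δ + ℓ) / 2) zb) +
        (-1) * (z * zb) ^ s *
          (chiralBlock ((Δ + ℓ) / 2) (1 - z) * chiralBlock ((Δ - ℓ) / 2) (1 - zb) +
            chiralBlock ((Δ - ℓ) / 2) (1 - z) * chiralBlock ((Δ + ℓ) / 2) (1 - zb)) := by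
    simp only [crossF, globalBlock]
  rw [hfun, hval]
  exact AB

/-! ### The (M)+(T) obligation and the termwise reduction -/

/-- **The above-threshold obligation in pair-monomial form** ((M) + (T) of `verify_points2d/1.1`):
`φ[F_-[x^a y^b + x^b y^a]] ≥ 0` for all real `a, b ≥ 0` with `a + b ≥ E₀` and `a - b ∈ ℤ`. In the
verifier's variables `E = a + b`, `j = |a - b|` this is `Φ(E, j) = ∑_d c_d s_d^E T_j(ξ_d) ≥ 0` for
real `E ≥ E₀` and integers `0 ≤ j ≤ E` — (M) checks it by interval Taylor forms on `[max(E₀,j), Δ⋆]`,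
(T) for `E ≥ Δ⋆` from one apex-bracket inequality. [cite: RattazziEtAl2008, §5.5] -/
def PairPositiveAbove (φ : (ℝ → ℝ → ℝ) →ₗ[ℝ] ℝ) (s E₀ : ℝ) : Prop :=
  ∀ a b : ℝ, 0 ≤ a → 0 ≤ b → E₀ ≤ a + b → (∃ j : ℤ, a - b = j) →
    0 ≤ φ (crossF s (-1) (pairPow a b))

/-- **Termwise reduction (PROVED).** For an evaluation-continuous functional — every point functional
with nodes in the open square — the pair-monomial obligation above `E₀` implies block positivity for
every `(Δ, ℓ)` with `ℓ ≤ Δ` and `E₀ ≤ Δ` (all spins; evenness is not needed): apply `φ` term by term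
to the non-negative pair-monomial expansion of `F_-[g_{Δ,ℓ}]`; term `(m, m')` has `a = h + m`,
`b = h̄ + m'`, `a + b = Δ + m + m' ≥ E₀`, `a - b = ℓ + m - m' ∈ ℤ`. This is the `d = 2` counterpart of
`Literature/…/ConformalBootstrap3D/PointFunctionalTermwise.lean`, with the block series explicit.
[cite: RattazziEtAl2008, §5.5] -/
theorem high_nonneg_of_pairPositive {φ : (ℝ → ℝ → ℝ) →ₗ[ℝ] ℝ} (hφ : EvaluationContinuous φ)
    {s E₀ : ℝ} (h : PairPositiveAbove φ s E₀) :
    ∀ ℓ : ℕ, ∀ Δ : ℝ, (ℓ : ℝ) ≤ Δ → E₀ ≤ Δ → BlockPositive φ s Δ ℓ := by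
  intro ℓ Δ hΔ hE
  have hℓ : (0 : ℝ) ≤ ℓ := Nat.cast_nonneg ℓ
  have hs := hφ.hasSum_mul
    (fun mm : ℕ × ℕ => chiralCoeff ((Δ + ℓ) / 2) mm.1 * chiralCoeff ((Δ - ℓ) / 2) mm.2)
    (fun mm => crossF s (-1) (pairPow ((Δ + ℓ) / 2 + (mm.1 : ℝ)) ((Δ - ℓ) / 2 + (mm.2 : ℝ))))
    (crossF s (-1) (globalBlock Δ ℓ))
    (fun z zb hz hzb => hasSum_crossF_globalBlock hΔ hz hzb)
  refine hs.nonneg fun mm => mul_nonneg ?_ ?_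
  · exact mul_nonneg (chiralCoeff_nonneg (by linarith) _) (chiralCoeff_nonneg (by linarith) _)
  · refine h _ _ ?_ ?_ ?_ ⟨(ℓ : ℤ) + mm.1 - mm.2, ?_⟩
    · have : (0 : ℝ) ≤ mm.1 := Nat.cast_nonneg _
      linarith
    · have : (0 : ℝ) ≤ mm.2 := Nat.cast_nonneg _
      linarith
    · have h1 : (0 : ℝ) ≤ mm.1 := Nat.cast_nonneg _
      have h2 : (0 : ℝ) ≤ mm.2 := Nat.cast_nonneg _
      linarith
    · push_cast
      ring

/-- **Termwise reduction for point functionals** (the case of every RB-0 certificate). PROVED.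
[cite: RattazziEtAl2008, §5.5] -/
theorem high_nonneg_of_pairPositive_points {n : ℕ} (w z zb : Fin n → ℝ)
    (hz : ∀ k, z k ∈ Ioo (0 : ℝ) 1) (hzb : ∀ k, zb k ∈ Ioo (0 : ℝ) 1) {s E₀ : ℝ}
    (h : PairPositiveAbove (pointFunctional w z zb) s E₀) :
    ∀ ℓ : ℕ, Even ℓ → ∀ Δ : ℝ, (ℓ : ℝ) ≤ Δ → E₀ ≤ Δ → BlockPositive (pointFunctional w z zb) s Δ ℓ :=
  fun ℓ _ Δ hΔ hE =>
    high_nonneg_of_pairPositive (evaluationContinuous_pointFunctional w z zb hz hzb) h ℓ Δ hΔ hE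

/-- **Gap certificate, termwise form.** A point functional with nodes in the open square, (I),
the cell rows below `E₀` and the pair-monomial obligation above `E₀` give `GapExcluded s U`.
PROVED (assembly of `GapObligations.of_table`, `high_nonneg_of_pairPositive_points`,
`gapExcluded_of_points`). [cite: RattazziEtAl2008, §5.5] -/
theorem gapExcluded_of_table_and_pairs {n : ℕ} (w z zb : Fin n → ℝ)
    (hz : ∀ k, z k ∈ Ioo (0 : ℝ) 1) (hzb : ∀ k, zb k ∈ Ioo (0 : ℝ) 1) {s U E₀ : ℝ} (L : ℕ)
    (hL : E₀ ≤ (L : ℝ))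
    (hI : 0 < pointFunctional w z zb (crossF s (-1) (fun _ _ => (1 : ℝ))))
    (hpair : PairPositiveAbove (pointFunctional w z zb) s E₀)
    (t₀ : ℕ → ℝ) {K₀ : ℕ} (hK₀ : 1 ≤ K₀) (ht₀ : t₀ 0 ≤ U) (ht₀' : E₀ ≤ t₀ K₀)
    (hcell₀ : ∀ k < K₀, CellPositive (pointFunctional w z zb) s 0 (t₀ k) (t₀ (k + 1)))
    (t : ℕ → ℕ → ℝ) (K : ℕ → ℕ) (hK : ∀ ℓ < L, 1 ≤ K ℓ) (ht : ∀ ℓ < L, t ℓ 0 ≤ (ℓ : ℝ))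
    (ht' : ∀ ℓ < L, E₀ ≤ t ℓ (K ℓ))
    (hcell : ∀ ℓ < L, Even ℓ → ℓ ≠ 0 → ∀ k < K ℓ,
      CellPositive (pointFunctional w z zb) s ℓ (t ℓ k) (t ℓ (k + 1))) :
    GapExcluded s U :=
  gapExcluded_of_points w z zb hz hzb
    (GapObligations.of_table L hL hI (high_nonneg_of_pairPositive_points w z zb hz hzb hpair)
      t₀ hK₀ ht₀ ht₀' hcell₀ t K hK ht ht' hcell)

end Summit.CriticalPhenomena.Ising3D.Control2D
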